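import Summits.MatrixMultiplication.OmegaCensus.DominoZ19StructSixRows4
import HarnessLib

/-!
# Completeness rows 15–18 , the remaining tuples and `checkSix` for the structural part-`6` route, `p = 19` (rows file 5 of 5)

ω-census `pub-omega`, family (b3), seat pub-omega-group gen 25.  Framing: lottery ticket; floor = certified bounds/negative
ranges.  VALUE: per-prime kernel data of the structural part-`6` route WITHOUT the pigeonhole (`DominoZpZpStructSixWide*.lean`)
for `p = 19` — target: the OPEN census cell `(1,6,20)@361` (`A = ℤ₁₉²`) and every larger order with such a quotient; NOT progress on ω.

-/

namespace Summit.MatrixMultiplication.OmegaCensus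

open ZpZpDomino

namespace ZpZpDomino

set_option maxRecDepth 100000 in
set_option maxHeartbeats 4000000 in
/-- Row `b = 15` of the completeness check (`19³` lookups). [folklore] -/
theorem checkSixRow_19_15 : checkSixRow 19 etZ19s6 tabTreeZ19s6 15 = true := by decide +kernel

set_option maxRecDepth 100000 in
set_option maxHeartbeats 4000000 in
/-- Row `b = 16` of the completeness check (`19³` lookups). [folklore] -/
theorem checkSixRow_19_16 : checkSixRow 19 etZ19s6 tabTreeZ19s6 16 = true := by decide +kernel

set_option maxRecDepth 100000 in
set_option maxHeartbeats 4000000 in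
/-- Row `b = 17` of the completeness check (`19³` lookups). [folklore] -/
theorem checkSixRow_19_17 : checkSixRow 19 etZ19s6 tabTreeZ19s6 17 = true := by decide +kernel

set_option maxRecDepth 100000 in
set_option maxHeartbeats 4000000 in
/-- Row `b = 18` of the completeness check (`19³` lookups). [folklore] -/
theorem checkSixRow_19_18 : checkSixRow 19 etZ19s6 tabTreeZ19s6 18 = true := by decide +kernel

set_option maxRecDepth 100000 in
set_option maxHeartbeats 4000000 in
/-- The remaining normalised tuples. [folklore] -/
theorem checkSixRest_19 : checkSixRest 19 etZ19s6 tabTreeZ19s6 = true := by decide +kernel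

/-- **Completeness** (rows assembled). [folklore] -/
theorem checkSix_19 : checkSix 19 etZ19s6 tabTreeZ19s6 = true := by
  refine checkSix_of_rows (fun b hb => ?_) checkSixRest_19
  interval_cases b
  exacts [checkSixRow_19_0, checkSixRow_19_1, checkSixRow_19_2, checkSixRow_19_3, checkSixRow_19_4, checkSixRow_19_5, checkSixRow_19_6, checkSixRow_19_7, checkSixRow_19_8, checkSixRow_19_9, checkSixRow_19_10, checkSixRow_19_11, checkSixRow_19_12, checkSixRow_19_13, checkSixRow_19_14, checkSixRow_19_15, checkSixRow_19_16, checkSixRow_19_17, checkSixRow_19_18]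

end ZpZpDomino

end Summit.MatrixMultiplication.OmegaCensus
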